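import Mathlib.MeasureTheory.Integral.IntervalIntegral.Basic
import Summits.FinalStateConjecture.FinalStateConjecture.Theorems.EIHFluxBalanceInertialRecessionStaircaseGap

/-!
# Route EIHFluxBalance — crux `InertialRecession` (E′), line `SketchCleanExcision`:
# the staircase, part 4 — the three costs of a step (static window law, identification, re-covering)

Helper file for the crux `stmt-FinalStateConjecture-17403`
(`Summit.FinalStateConjecture.FinalStateConjecture.Theses.EIHFluxBalance.InertialRecession`), registered stub
`stub_integratedClusterBalance` (skeleton r12, `Cruxes/InertialRecession/Lines/SketchCleanExcision.lean`).

For abstract charges `P t c R μ` and the kinematic energy–momentum `kin⟦M, v, A, s⟧` of a member set: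
* `identified_fin` — the IDENTIFICATION instance in `Fin 4` form; `kin_eq_sum_reps` — `kin` is additive over
  the classes of a gap scale (part 1);
* `excision_finset` — the CLEAN EXCISION hypothesis (EXC), stated for `Fin m`-indexed sub-windows, transported
  to `Finset`-indexed families;
* `static_cost` — holding a cover static over `[s₀, s]` costs `≤ N·C_W·(s − s₀)·((4σ)^{3/2})⁻¹` by the window
  law along constant paths;
* `cover_identification` — a cover's total charge is the member set's `kin` up to `N·ζ`;
* `switch_cost` — an old cover and a refinement built inside it differ in total charge by
  `≤ N·C_E·(√(4σ_r))⁻¹` (excision once per old window, fibrewise over the old classes).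
Mathlib only (plus part 1). [folklore]
-/

noncomputable section

set_option linter.dupNamespace false

open scoped BigOperators Classical
open Finset MeasureTheory intervalIntegral

namespace Summit.FinalStateConjecture.FinalStateConjecture.Theorems.SublinearIsFree.Staircase

open Literature.Geometry.Lorentzian


variable {N : ℕ}

/-! ### The kinematic energy–momentum of a member set -/

/-- `kin` is additive over the classes of a gap scale. [folklore] -/
theorem kin_eq_sum_reps (M : Fin N → ℝ) (v : Fin N → ℝ → E3) (ξ : Fin N → ℝ → E3) (s₀ : ℝ) (S : Finset (Fin N))
    (σ s : ℝ) (μ : Fin 4) : (Fin.cons (∑ jj ∈ S, M jj * (√(1 - ‖v jj s‖ ^ 2))⁻¹) (fun kk ↦ ∑ jj ∈ S, M jj * (√(1 - ‖v jj s‖ ^ 2))⁻¹ * v jj s kk) : Fin 4 → ℝ) μ =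
      ∑ p ∈ (Finset.image (fun ii ↦ (dite (Finset.Nonempty (Finset.filter (fun jj ↦ ‖ξ ii s₀ - ξ jj s₀‖ < σ) S)) (fun hh ↦ Finset.min' (Finset.filter (fun jj ↦ ‖ξ ii s₀ - ξ jj s₀‖ < σ) S) hh) (fun _ ↦ ii))) S), (Fin.cons (∑ jj ∈ (S.filter fun j ↦ (dite (Finset.Nonempty (Finset.filter (fun jj ↦ ‖ξ j s₀ - ξ jj s₀‖ < σ) S)) (fun hh ↦ Finset.min' (Finset.filter (fun jj ↦ ‖ξ j s₀ - ξ jj s₀‖ < σ) S) hh) (fun _ ↦ j)) = p), M jj * (√(1 - ‖v jj s‖ ^ 2))⁻¹) (fun kk ↦ ∑ jj ∈ (S.filter fun j ↦ (dite (Finset.Nonempty (Finset.filter (fun jj ↦ ‖ξ j s₀ - ξ jj s₀‖ < σ) S)) (fun hh ↦ Finset.min' (Finset.filter (fun jj ↦ ‖ξ j s₀ - ξ jj s₀‖ < σ) S) hh) (fun _ ↦ j)) = p), M jj * (√(1 - ‖v jj s‖ ^ 2))⁻¹ * v jj s kk) : Fin 4 → ℝ) μ := by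
  refine Fin.cases ?_ (fun k ↦ ?_) μ
  · simp only [Fin.cons_zero]
    exact sum_eq_sum_reps _
  · simp only [Fin.cons_succ]
    exact sum_eq_sum_reps _

/-- The identification instance in `Fin 4` form. [folklore] -/
theorem identified_fin {P : ℝ → E3 → ℝ → Fin 4 → ℝ} {M : Fin N → ℝ} {v : Fin N → ℝ → E3} {t : ℝ} {c : E3} {R z : ℝ}
    {A : Finset (Fin N)}
    (h : |P t c R 0 - ∑ j ∈ A, M j * (√(1 - ‖v j t‖ ^ 2))⁻¹| ≤ z ∧
      ∀ k : Fin 3, |P t c R k.succ - ∑ j ∈ A, M j * (√(1 - ‖v j t‖ ^ 2))⁻¹ * v j t k| ≤ z) :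
    ∀ μ : Fin 4, |P t c R μ - (Fin.cons (∑ jj ∈ A, M jj * (√(1 - ‖v jj t‖ ^ 2))⁻¹) (fun kk ↦ ∑ jj ∈ A, M jj * (√(1 - ‖v jj t‖ ^ 2))⁻¹ * v jj t kk) : Fin 4 → ℝ) μ| ≤ z := by
  refine Fin.cases ?_ (fun k ↦ ?_)
  · simpa only [Fin.cons_zero] using h.1
  · simpa only [Fin.cons_succ] using h.2 k

/-! ### Clean excision for `Finset`-indexed sub-windows -/

/-- **(EXC) transported from `Fin m`-indexed to `Finset`-indexed families of sub-windows.** [folklore] -/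
theorem excision_finset {P : ℝ → E3 → ℝ → Fin 4 → ℝ} {ξ : Fin N → ℝ → E3} {t : ℝ} {c : E3} {R Rm C δ : ℝ}
    (hE : ∀ (m : ℕ) (c' : Fin m → E3) (R' : Fin m → ℝ), (∀ k, Rm ≤ R' k) →
      (∀ k j, ‖ξ j t - c' k‖ ≤ (1 - δ) * R' k ∨ (1 + δ) * R' k ≤ ‖ξ j t - c' k‖) →
      (∀ k, ‖c' k - c‖ + (1 + δ) * R' k ≤ (1 - δ) * R) →
      (∀ k l, k ≠ l → (1 + δ) * (R' k + R' l) ≤ ‖c' k - c' l‖) →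
      (∀ j, ‖ξ j t - c‖ ≤ (1 - δ) * R → ∃ k, ‖ξ j t - c' k‖ ≤ (1 - δ) * R' k) →
      ∀ μ : Fin 4, |P t c R μ - ∑ k, P t (c' k) (R' k) μ| ≤ C * (√Rm)⁻¹)
    {ι : Type*} (I : Finset ι) (c' : ι → E3) (R' : ι → ℝ) (h1 : ∀ k ∈ I, Rm ≤ R' k)
    (h2 : ∀ k ∈ I, ∀ j, ‖ξ j t - c' k‖ ≤ (1 - δ) * R' k ∨ (1 + δ) * R' k ≤ ‖ξ j t - c' k‖)
    (h3 : ∀ k ∈ I, ‖c' k - c‖ + (1 + δ) * R' k ≤ (1 - δ) * R)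
    (h4 : ∀ k ∈ I, ∀ l ∈ I, k ≠ l → (1 + δ) * (R' k + R' l) ≤ ‖c' k - c' l‖)
    (h5 : ∀ j, ‖ξ j t - c‖ ≤ (1 - δ) * R → ∃ k ∈ I, ‖ξ j t - c' k‖ ≤ (1 - δ) * R' k) :
    ∀ μ : Fin 4, |P t c R μ - ∑ k ∈ I, P t (c' k) (R' k) μ| ≤ C * (√Rm)⁻¹ := by
  intro μ
  set e := I.equivFin with he
  have key := hE I.card (fun k ↦ c' (e.symm k)) (fun k ↦ R' (e.symm k)) (fun k ↦ h1 _ (e.symm k).2)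
    (fun k j ↦ h2 _ (e.symm k).2 j) (fun k ↦ h3 _ (e.symm k).2)
    (fun k l hkl ↦ h4 _ (e.symm k).2 _ (e.symm l).2 fun h ↦ hkl (e.symm.injective (Subtype.ext h)))
    (fun j hj ↦ by
      obtain ⟨k, hk, h⟩ := h5 j hj
      exact ⟨e ⟨k, hk⟩, by simpa using h⟩) μ
  have hsum : ∑ k : Fin I.card, P t (c' (e.symm k)) (R' (e.symm k)) μ = ∑ k ∈ I, P t (c' k) (R' k) μ := by
    rw [← Finset.sum_coe_sort I]
    exact Fintype.sum_equiv e.symm _ _ fun k ↦ rfl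
  rwa [hsum] at key

/-! ### Sums of bounded differences -/

/-- `|Σ_I (a − b)| ≤ #I · B` from termwise bounds. [folklore] -/
theorem abs_sum_sub_le {ι : Type*} (I : Finset ι) (a b : ι → ℝ) {B : ℝ} (h : ∀ k ∈ I, |a k - b k| ≤ B) :
    |∑ k ∈ I, a k - ∑ k ∈ I, b k| ≤ I.card * B := by
  rw [← Finset.sum_sub_distrib]
  calc |∑ k ∈ I, (a k - b k)| ≤ ∑ k ∈ I, |a k - b k| := Finset.abs_sum_le_sum_abs _ _
    _ ≤ ∑ _k ∈ I, B := Finset.sum_le_sum h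
    _ = I.card * B := by simp

/-! ### Cost 1: holding a cover static (window law along constant paths) -/

/-- **STATIC COST.** For an instance `hWL` of the window law (clearance `1/8`, constant `C_W`, after `T_W`)
and a finite family `Rp` (`#Rp ≤ N`) of static windows `(ξ p s₀, 4σ)` which are admissible, in the cone and
above the threshold at every time of `[s₀, s]`, the total charge changes by at most
`N·max(C_W,0)·(s − s₀)·((4σ)^{3/2})⁻¹` (window law along the constant paths). [folklore] -/
theorem static_cost {P : ℝ → E3 → ℝ → Fin 4 → ℝ} {ξ : Fin N → ℝ → E3} {ρ : ℝ → ℝ} {κ C_W T_W s₀ s σ : ℝ}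
    (hWL : ∀ (t₁ t₂ : ℝ) (c : ℝ → E3) (R : ℝ → ℝ), T_W ≤ t₁ → t₁ ≤ t₂ →
      (∀ s ∈ Set.Icc t₁ t₂, ∀ s' ∈ Set.Icc t₁ t₂, ‖c s - c s'‖ ≤ 2 * |s - s'| ∧ |R s - R s'| ≤ 2 * |s - s'|) →
      (∀ s ∈ Set.Icc t₁ t₂, ρ s ≤ 1 / 8 * R s ∧ ‖c s‖ + R s ≤ (κ + κ ^ 2) / 2 * s ∧
        ∀ j, ‖ξ j s - c s‖ ≤ (1 - 1 / 8) * R s ∨ (1 + 1 / 8) * R s ≤ ‖ξ j s - c s‖) →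
      ∀ μ : Fin 4, |P t₂ (c t₂) (R t₂) μ - P t₁ (c t₁) (R t₁) μ| ≤ C_W * ∫ s in t₁..t₂, (R s ^ (3 / 2 : ℝ))⁻¹)
    (hT : T_W ≤ s₀) (hs : s₀ ≤ s) (hσ : 0 < σ) {Rp : Finset (Fin N)} (hcard : Rp.card ≤ N)
    (hadm : ∀ s' ∈ Set.Icc s₀ s, ∀ p ∈ Rp, ρ s' ≤ 1 / 8 * (4 * σ) ∧ ‖ξ p s₀‖ + 4 * σ ≤ (κ + κ ^ 2) / 2 * s' ∧
      ∀ j, ‖ξ j s' - ξ p s₀‖ ≤ (1 - 1 / 8) * (4 * σ) ∨ (1 + 1 / 8) * (4 * σ) ≤ ‖ξ j s' - ξ p s₀‖) :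
    ∀ μ : Fin 4, |∑ p ∈ Rp, P s (ξ p s₀) (4 * σ) μ - ∑ p ∈ Rp, P s₀ (ξ p s₀) (4 * σ) μ| ≤
      N * max C_W 0 * (s - s₀) * ((4 * σ) ^ (3 / 2 : ℝ))⁻¹ := by
  intro μ
  have hX : 0 ≤ (s - s₀) * ((4 * σ) ^ (3 / 2 : ℝ))⁻¹ := by
    have : 0 ≤ ((4 * σ) ^ (3 / 2 : ℝ))⁻¹ := by positivity
    have : 0 ≤ s - s₀ := by linarith
    positivity
  have hwin : ∀ p ∈ Rp, |P s (ξ p s₀) (4 * σ) μ - P s₀ (ξ p s₀) (4 * σ) μ| ≤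
      max C_W 0 * ((s - s₀) * ((4 * σ) ^ (3 / 2 : ℝ))⁻¹) := by
    intro p hp
    have h := hWL s₀ s (fun _ ↦ ξ p s₀) (fun _ ↦ 4 * σ) hT hs
      (fun _ _ _ _ ↦ ⟨by simp, by simp⟩) (fun s' hs' ↦ hadm s' hs' p hp) μ
    rw [intervalIntegral.integral_const, smul_eq_mul] at h
    exact h.trans (mul_le_mul_of_nonneg_right (le_max_left _ _) hX)
  calc |∑ p ∈ Rp, P s (ξ p s₀) (4 * σ) μ - ∑ p ∈ Rp, P s₀ (ξ p s₀) (4 * σ) μ|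
      ≤ Rp.card * (max C_W 0 * ((s - s₀) * ((4 * σ) ^ (3 / 2 : ℝ))⁻¹)) := abs_sum_sub_le Rp _ _ hwin
    _ ≤ N * (max C_W 0 * ((s - s₀) * ((4 * σ) ^ (3 / 2 : ℝ))⁻¹)) := by gcongr
    _ = _ := by ring

/-! ### Cost 2: identification of a cover -/

/-- **COVER IDENTIFICATION.** For an instance `hID` of the identification (clearance `1/8`, error `ζ ≥ 0` at
time `s`, after `T_I`): the total charge of the cover built from the gap scale `σ` at `s₀` (windows
`(ξ p s₀, 4σ)`, `p` a representative), observed at a time `s` at which each window is admissible, in the cone,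
above the threshold and has member set = its class, equals `kin⟦M, v, S, s⟧` up to `N·ζ s`. [folklore] -/
theorem cover_identification {P : ℝ → E3 → ℝ → Fin 4 → ℝ} {M : Fin N → ℝ} {ξ v : Fin N → ℝ → E3} {ρ ζ : ℝ → ℝ}
    {κ T_I s₀ s σ : ℝ} {S : Finset (Fin N)}
    (hID : ∀ (t : ℝ) (c : E3) (R : ℝ) (A : Finset (Fin N)), T_I ≤ t → ρ t ≤ 1 / 8 * R →
      ‖c‖ + R ≤ (κ + κ ^ 2) / 2 * t →
      (∀ j, ‖ξ j t - c‖ ≤ (1 - 1 / 8) * R ∨ (1 + 1 / 8) * R ≤ ‖ξ j t - c‖) →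
      (∀ j, j ∈ A ↔ ‖ξ j t - c‖ ≤ (1 - 1 / 8) * R) →
      |P t c R 0 - ∑ j ∈ A, M j * (√(1 - ‖v j t‖ ^ 2))⁻¹| ≤ ζ t ∧
      ∀ k : Fin 3, |P t c R k.succ - ∑ j ∈ A, M j * (√(1 - ‖v j t‖ ^ 2))⁻¹ * v j t k| ≤ ζ t)
    (hT : T_I ≤ s) (hζ : 0 ≤ ζ s)
    (hadm : ∀ p ∈ (Finset.image (fun ii ↦ (dite (Finset.Nonempty (Finset.filter (fun jj ↦ ‖ξ ii s₀ - ξ jj s₀‖ < σ) S)) (fun hh ↦ Finset.min' (Finset.filter (fun jj ↦ ‖ξ ii s₀ - ξ jj s₀‖ < σ) S) hh) (fun _ ↦ ii))) S), ρ s ≤ 1 / 8 * (4 * σ) ∧ ‖ξ p s₀‖ + 4 * σ ≤ (κ + κ ^ 2) / 2 * s ∧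
      ∀ j, ‖ξ j s - ξ p s₀‖ ≤ (1 - 1 / 8) * (4 * σ) ∨ (1 + 1 / 8) * (4 * σ) ≤ ‖ξ j s - ξ p s₀‖)
    (hmem : ∀ p ∈ (Finset.image (fun ii ↦ (dite (Finset.Nonempty (Finset.filter (fun jj ↦ ‖ξ ii s₀ - ξ jj s₀‖ < σ) S)) (fun hh ↦ Finset.min' (Finset.filter (fun jj ↦ ‖ξ ii s₀ - ξ jj s₀‖ < σ) S) hh) (fun _ ↦ ii))) S), ∀ j,
      j ∈ S.filter (fun j ↦ (dite (Finset.Nonempty (Finset.filter (fun jj ↦ ‖ξ j s₀ - ξ jj s₀‖ < σ) S)) (fun hh ↦ Finset.min' (Finset.filter (fun jj ↦ ‖ξ j s₀ - ξ jj s₀‖ < σ) S) hh) (fun _ ↦ j)) = p) ↔ ‖ξ j s - ξ p s₀‖ ≤ (1 - 1 / 8) * (4 * σ)) :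
    ∀ μ : Fin 4, |∑ p ∈ (Finset.image (fun ii ↦ (dite (Finset.Nonempty (Finset.filter (fun jj ↦ ‖ξ ii s₀ - ξ jj s₀‖ < σ) S)) (fun hh ↦ Finset.min' (Finset.filter (fun jj ↦ ‖ξ ii s₀ - ξ jj s₀‖ < σ) S) hh) (fun _ ↦ ii))) S), P s (ξ p s₀) (4 * σ) μ - (Fin.cons (∑ jj ∈ S, M jj * (√(1 - ‖v jj s‖ ^ 2))⁻¹) (fun kk ↦ ∑ jj ∈ S, M jj * (√(1 - ‖v jj s‖ ^ 2))⁻¹ * v jj s kk) : Fin 4 → ℝ) μ| ≤ N * ζ s := by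
  intro μ
  rw [kin_eq_sum_reps M v ξ s₀ S σ s μ]
  have hwin : ∀ p ∈ (Finset.image (fun ii ↦ (dite (Finset.Nonempty (Finset.filter (fun jj ↦ ‖ξ ii s₀ - ξ jj s₀‖ < σ) S)) (fun hh ↦ Finset.min' (Finset.filter (fun jj ↦ ‖ξ ii s₀ - ξ jj s₀‖ < σ) S) hh) (fun _ ↦ ii))) S),
      |P s (ξ p s₀) (4 * σ) μ - (Fin.cons (∑ jj ∈ (S.filter fun j ↦ (dite (Finset.Nonempty (Finset.filter (fun jj ↦ ‖ξ j s₀ - ξ jj s₀‖ < σ) S)) (fun hh ↦ Finset.min' (Finset.filter (fun jj ↦ ‖ξ j s₀ - ξ jj s₀‖ < σ) S) hh) (fun _ ↦ j)) = p), M jj * (√(1 - ‖v jj s‖ ^ 2))⁻¹) (fun kk ↦ ∑ jj ∈ (S.filter fun j ↦ (dite (Finset.Nonempty (Finset.filter (fun jj ↦ ‖ξ j s₀ - ξ jj s₀‖ < σ) S)) (fun hh ↦ Finset.min' (Finset.filter (fun jj ↦ ‖ξ j s₀ - ξ jj s₀‖ < σ) S) hh) (fun _ ↦ j)) = p), M jj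 * (√(1 - ‖v jj s‖ ^ 2))⁻¹ * v jj s kk) : Fin 4 → ℝ) μ| ≤ ζ s := fun p hp ↦
    identified_fin (hID s (ξ p s₀) (4 * σ) _ hT (hadm p hp).1 (hadm p hp).2.1 (hadm p hp).2.2 (hmem p hp)) μ
  calc _ ≤ ((Finset.image (fun ii ↦ (dite (Finset.Nonempty (Finset.filter (fun jj ↦ ‖ξ ii s₀ - ξ jj s₀‖ < σ) S)) (fun hh ↦ Finset.min' (Finset.filter (fun jj ↦ ‖ξ ii s₀ - ξ jj s₀‖ < σ) S) hh) (fun _ ↦ ii))) S)).card * ζ s := abs_sum_sub_le _ _ _ hwin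
    _ ≤ N * ζ s := by gcongr; exact_mod_cast card_reps_le

/-! ### Cost 3: re-covering (clean excision between a cover and a refinement) -/

/-- **SWITCH COST.** An instance `hE` of clean excision at time `s` (clearance `1/8`, constant `C_E ≥ 0`,
`Finset`-indexed sub-windows, cf. `excision_finset`); an OLD cover (gap scale `σ` at `s₀`, windows
`(ξ p s₀, 4σ)`, observed at `s`: admissible, in the cone, inside ⇒ member of the class, members within `3σ/2`);
a REFINEMENT (gap scale `σ_r ≤ σ/16` of the configuration at `s`, windows `(ξ q s, 4σ_r)`: admissible,
representatives `16σ_r` apart, above the threshold) COMPATIBLE with the old classes (`rep₀ ∘ rep_r = rep₀` on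
`S`). Then the two total charges differ by at most `N·C_E·(√(4σ_r))⁻¹`. [folklore] -/
theorem switch_cost {P : ℝ → E3 → ℝ → Fin 4 → ℝ} {ξ : Fin N → ℝ → E3} {ρ : ℝ → ℝ} {κ C_E s₀ s σ σr : ℝ}
    {S : Finset (Fin N)}
    (hE : ∀ (c : E3) (R Rm : ℝ) (I : Finset (Fin N)) (c' : Fin N → E3) (R' : Fin N → ℝ), 0 < Rm →
      ρ s ≤ 1 / 8 * Rm → Rm ≤ R → (∀ k ∈ I, Rm ≤ R' k) → ‖c‖ + R ≤ (κ + κ ^ 2) / 2 * s →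
      (∀ j, ‖ξ j s - c‖ ≤ (1 - 1 / 8) * R ∨ (1 + 1 / 8) * R ≤ ‖ξ j s - c‖) →
      (∀ k ∈ I, ∀ j, ‖ξ j s - c' k‖ ≤ (1 - 1 / 8) * R' k ∨ (1 + 1 / 8) * R' k ≤ ‖ξ j s - c' k‖) →
      (∀ k ∈ I, ‖c' k - c‖ + (1 + 1 / 8) * R' k ≤ (1 - 1 / 8) * R) →
      (∀ k ∈ I, ∀ l ∈ I, k ≠ l → (1 + 1 / 8) * (R' k + R' l) ≤ ‖c' k - c' l‖) →
      (∀ j, ‖ξ j s - c‖ ≤ (1 - 1 / 8) * R → ∃ k ∈ I, ‖ξ j s - c' k‖ ≤ (1 - 1 / 8) * R' k) →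
      ∀ μ : Fin 4, |P s c R μ - ∑ k ∈ I, P s (c' k) (R' k) μ| ≤ C_E * (√Rm)⁻¹)
    (hC : 0 ≤ C_E) (hσr : 0 < σr) (hσrσ : σr ≤ σ / 16)
    -- the old cover at observation time `s`
    (hadm₀ : ∀ p ∈ (Finset.image (fun ii ↦ (dite (Finset.Nonempty (Finset.filter (fun jj ↦ ‖ξ ii s₀ - ξ jj s₀‖ < σ) S)) (fun hh ↦ Finset.min' (Finset.filter (fun jj ↦ ‖ξ ii s₀ - ξ jj s₀‖ < σ) S) hh) (fun _ ↦ ii))) S), ‖ξ p s₀‖ + 4 * σ ≤ (κ + κ ^ 2) / 2 * s ∧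
      ∀ j, ‖ξ j s - ξ p s₀‖ ≤ (1 - 1 / 8) * (4 * σ) ∨ (1 + 1 / 8) * (4 * σ) ≤ ‖ξ j s - ξ p s₀‖)
    (hins₀ : ∀ p ∈ (Finset.image (fun ii ↦ (dite (Finset.Nonempty (Finset.filter (fun jj ↦ ‖ξ ii s₀ - ξ jj s₀‖ < σ) S)) (fun hh ↦ Finset.min' (Finset.filter (fun jj ↦ ‖ξ ii s₀ - ξ jj s₀‖ < σ) S) hh) (fun _ ↦ ii))) S), ∀ j, ‖ξ j s - ξ p s₀‖ ≤ (1 - 1 / 8) * (4 * σ) →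
      j ∈ S ∧ (dite (Finset.Nonempty (Finset.filter (fun jj ↦ ‖ξ j s₀ - ξ jj s₀‖ < σ) S)) (fun hh ↦ Finset.min' (Finset.filter (fun jj ↦ ‖ξ j s₀ - ξ jj s₀‖ < σ) S) hh) (fun _ ↦ j)) = p)
    (hcls₀ : ∀ j ∈ S, ∀ p ∈ (Finset.image (fun ii ↦ (dite (Finset.Nonempty (Finset.filter (fun jj ↦ ‖ξ ii s₀ - ξ jj s₀‖ < σ) S)) (fun hh ↦ Finset.min' (Finset.filter (fun jj ↦ ‖ξ ii s₀ - ξ jj s₀‖ < σ) S) hh) (fun _ ↦ ii))) S), (dite (Finset.Nonempty (Finset.filter (fun jj ↦ ‖ξ j s₀ - ξ jj s₀‖ < σ) S)) (fun hh ↦ Finset.min' (Finset.filter (fun jj ↦ ‖ξ j s₀ - ξ jj s₀‖ < σ) S) hh) (fun _ ↦ j)) = p → ‖ξ j s - ξ p s₀‖ ≤ 3 * σ / 2)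
    -- the refinement, created at `s`
    (hgapr : ∀ i ∈ S, ∀ j ∈ S, ‖ξ i s - ξ j s‖ < σr ∨ 16 * σr ≤ ‖ξ i s - ξ j s‖)
    (hthr : ρ s ≤ 1 / 8 * (4 * σr))
    (hadmr : ∀ q ∈ (Finset.image (fun ii ↦ (dite (Finset.Nonempty (Finset.filter (fun jj ↦ ‖ξ ii s - ξ jj s‖ < σr) S)) (fun hh ↦ Finset.min' (Finset.filter (fun jj ↦ ‖ξ ii s - ξ jj s‖ < σr) S) hh) (fun _ ↦ ii))) S),
      ∀ j, ‖ξ j s - ξ q s‖ ≤ (1 - 1 / 8) * (4 * σr) ∨ (1 + 1 / 8) * (4 * σr) ≤ ‖ξ j s - ξ q s‖)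
    -- compatibility of the classes
    (hcompat : ∀ j ∈ S, (dite (Finset.Nonempty (Finset.filter (fun jj ↦ ‖ξ (dite (Finset.Nonempty (Finset.filter (fun jj ↦ ‖ξ j s - ξ jj s‖ < σr) S)) (fun hh ↦ Finset.min' (Finset.filter (fun jj ↦ ‖ξ j s - ξ jj s‖ < σr) S) hh) (fun _ ↦ j)) s₀ - ξ jj s₀‖ < σ) S)) (fun hh ↦ Finset.min' (Finset.filter (fun jj ↦ ‖ξ (dite (Finset.Nonempty (Finset.filter (fun jj ↦ ‖ξ j s - ξ jj s‖ < σr) S)) (fun hh ↦ Finset.min' (Finset.filter (fun jj ↦ ‖ξ j s - ξ jj s‖ < σr) S) hh) (fun _ ↦ j)) s₀ - ξ jj s₀‖ < σ) S) hh) (fun _ ↦ (dite (Finset.Nonempty (Finset.filter (fun jj ↦ ‖ξ j s - ξ jj s‖ < σr) S)) (fun hh ↦ Finset.min' (Finset.filter (fun jj ↦ ‖ξ j s - ξ jj s‖ < σr) S) hh) (fun _ ↦ j)))) = (dite (Finset.Nonempty (Finset.filter (fun jj ↦ ‖ξ j s₀ - ξ jj s₀‖ < σ) S)) (fun hh ↦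 Finset.min' (Finset.filter (fun jj ↦ ‖ξ j s₀ - ξ jj s₀‖ < σ) S) hh) (fun _ ↦ j))) :
    ∀ μ : Fin 4, |∑ p ∈ (Finset.image (fun ii ↦ (dite (Finset.Nonempty (Finset.filter (fun jj ↦ ‖ξ ii s₀ - ξ jj s₀‖ < σ) S)) (fun hh ↦ Finset.min' (Finset.filter (fun jj ↦ ‖ξ ii s₀ - ξ jj s₀‖ < σ) S) hh) (fun _ ↦ ii))) S), P s (ξ p s₀) (4 * σ) μ -
      ∑ q ∈ (Finset.image (fun ii ↦ (dite (Finset.Nonempty (Finset.filter (fun jj ↦ ‖ξ ii s - ξ jj s‖ < σr) S)) (fun hh ↦ Finset.min' (Finset.filter (fun jj ↦ ‖ξ ii s - ξ jj s‖ < σr) S) hh) (fun _ ↦ ii))) S), P s (ξ q s) (4 * σr) μ| ≤ N * C_E * (√(4 * σr))⁻¹ := by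
  intro μ
  -- the refinement splits along the old classes
  have hmaps : ∀ q ∈ (Finset.image (fun ii ↦ (dite (Finset.Nonempty (Finset.filter (fun jj ↦ ‖ξ ii s - ξ jj s‖ < σr) S)) (fun hh ↦ Finset.min' (Finset.filter (fun jj ↦ ‖ξ ii s - ξ jj s‖ < σr) S) hh) (fun _ ↦ ii))) S), (dite (Finset.Nonempty (Finset.filter (fun jj ↦ ‖ξ q s₀ - ξ jj s₀‖ < σ) S)) (fun hh ↦ Finset.min' (Finset.filter (fun jj ↦ ‖ξ q s₀ - ξ jj s₀‖ < σ) S) hh) (fun _ ↦ q)) ∈ (Finset.image (fun ii ↦ (dite (Finset.Nonempty (Finset.filter (fun jj ↦ ‖ξ ii s₀ - ξ jj s₀‖ < σ) S)) (fun hh ↦ Finset.min' (Finset.filter (fun jj ↦ ‖ξ ii s₀ - ξ jj s₀‖ < σ) S) hh) (fun _ ↦ ii))) S) := fun q hq ↦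
    rep_mem_reps (reps_subset hσr hq)
  rw [← Finset.sum_fiberwise_of_maps_to hmaps]
  have hwin : ∀ p ∈ (Finset.image (fun ii ↦ (dite (Finset.Nonempty (Finset.filter (fun jj ↦ ‖ξ ii s₀ - ξ jj s₀‖ < σ) S)) (fun hh ↦ Finset.min' (Finset.filter (fun jj ↦ ‖ξ ii s₀ - ξ jj s₀‖ < σ) S) hh) (fun _ ↦ ii))) S), |P s (ξ p s₀) (4 * σ) μ -
      ∑ q ∈ ((Finset.image (fun ii ↦ (dite (Finset.Nonempty (Finset.filter (fun jj ↦ ‖ξ ii s - ξ jj s‖ < σr) S)) (fun hh ↦ Finset.min' (Finset.filter (fun jj ↦ ‖ξ ii s - ξ jj s‖ < σr) S) hh) (fun _ ↦ ii))) S)).filter (fun q ↦ (dite (Finset.Nonempty (Finset.filter (fun jj ↦ ‖ξ q s₀ - ξ jj s₀‖ < σ) S)) (fun hh ↦ Finset.min' (Finset.filter (fun jj ↦ ‖ξ q s₀ - ξ jj s₀‖ < σ) S) hh) (fun _ ↦ q)) = p), P s (ξ q s) (4 * σr) μ| ≤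
      C_E * (√(4 * σr))⁻¹ := by
    intro p hp
    refine hE (ξ p s₀) (4 * σ) (4 * σr) _ (fun q ↦ ξ q s) (fun _ ↦ 4 * σr) (by positivity) hthr (by linarith)
      (fun _ _ ↦ le_rfl) (hadm₀ p hp).1 (hadm₀ p hp).2 (fun q hq ↦ hadmr q (Finset.mem_filter.mp hq).1)
      (fun q hq ↦ ?_) (fun q hq q' hq' hqq' ↦ ?_) (fun j hj ↦ ?_) μ
    · -- nesting
      obtain ⟨hq, hqp⟩ := Finset.mem_filter.mp hq
      have h1 := hcls₀ q (reps_subset hσr hq) p hp hqp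
      linarith
    · -- separation of distinct refinement windows
      have h1 := le_norm_sub_of_ne hσr hgapr (Finset.mem_filter.mp hq).1 (Finset.mem_filter.mp hq').1 hqq'
      linarith
    · -- coverage
      obtain ⟨hjS, hjp⟩ := hins₀ p hp j hj
      refine ⟨(dite (Finset.Nonempty (Finset.filter (fun jj ↦ ‖ξ j s - ξ jj s‖ < σr) S)) (fun hh ↦ Finset.min' (Finset.filter (fun jj ↦ ‖ξ j s - ξ jj s‖ < σr) S) hh) (fun _ ↦ j)), Finset.mem_filter.mpr ⟨rep_mem_reps hjS, ?_⟩, ?_⟩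
      · rw [hcompat j hjS, hjp]
      · have h1 := norm_sub_rep_lt (ξ := ξ) (s := s) (S := S) hσr hjS
        linarith
  calc _ ≤ ((Finset.image (fun ii ↦ (dite (Finset.Nonempty (Finset.filter (fun jj ↦ ‖ξ ii s₀ - ξ jj s₀‖ < σ) S)) (fun hh ↦ Finset.min' (Finset.filter (fun jj ↦ ‖ξ ii s₀ - ξ jj s₀‖ < σ) S) hh) (fun _ ↦ ii))) S)).card * (C_E * (√(4 * σr))⁻¹) := abs_sum_sub_le _ _ _ hwin
    _ ≤ N * (C_E * (√(4 * σr))⁻¹) := by gcongr; exact_mod_cast card_reps_le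
    _ = _ := by ring

/-- Registered one-line form (carrier `abs_sum_sub_le_sce12` of the crux item) of `abs_sum_sub_le`. [folklore] -/
theorem abs_sum_sub_le_sce12 : ∀ (n : ℕ) (I : Finset (Fin n)) (a b : Fin n → ℝ) (B : ℝ), (∀ k ∈ I, |a k - b k| ≤ B) → |∑ k ∈ I, a k - ∑ k ∈ I, b k| ≤ I.card * B :=
  fun _ I a b _ h ↦ abs_sum_sub_le I a b h

end Summit.FinalStateConjecture.FinalStateConjecture.Theorems.SublinearIsFree.Staircase

end
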